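import Mathlib

/-!
# Typed sectioning certificates: the Ahlswede–Daykin induction with per-minuend menus (hp-7 gen 81)

Helper file for crux `stmt-CriticalPhenomena-4575` (`NoHeavyLowerTail`, route `PercNearOneGluingNoHeavy`), hull-port seat
`prim-hp-7` (generation 81); `--supports stmt-CriticalPhenomena-4575 --as helper`.  Pure finite set theory; everything is PROVED.
Memo: `run/shared/lean/prim/prim-hp-7/FROM-prim-hp-7-g81-CERTIFICATE-CALCULUS.md` §1.

**Setting.**  A *menu system* is a finite family `𝒮` of finite sets ('minuends') together with a menu `M S` of allowed
subtrahends for every minuend `S`; its terms are the differences `S \ T` with `S ∈ 𝒮`, `T ∈ M S`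
(`TypedSectioning.terms`).  We want the lower bound `#𝒮 ≤ #(terms 𝒮 M)`.  With one menu for all minuends and the hypothesis
'every minuend contains a member of the menu' this is the Ahlswede–Daykin difference inequality (Ahlswede–Daykin 1979, Theorem 37;
tree: `Literature.Combinatorics.SetFamily.AhlswedeDaykinDifferences`), proved by SECTIONING at an element `r`: the 'doubled'
family `𝒮₁ = {X : r ∉ X, X ∈ 𝒮, insert r X ∈ 𝒮}` and the projection `𝒮₂ = {S.erase r}` satisfy `#𝒮 = #𝒮₁ + #𝒮₂`, and differences
of the two children glue injectively into differences of `𝒮` (`E ↦ insert r E` on the first child, `E ↦ E` or `insert r E` on the second).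

This file isolates the gluing step for ARBITRARY menus.  The doubled child keeps, for the pair `(X, insert r X)`, only the
subtrahends that serve BOTH and avoid `r` (`dblMenu`); the projected child takes, for `S.erase r`, the projections of the menus of
all its preimages (`projMenu`).  No hypothesis relating minuends and menus is needed for the gluing, so a *certificate* is simply a
tree of sectioning choices whose leaves are trivial (`TypedSectioning.Cert`: the empty system, or the system `{∅}` with `∅` on the
menu of `∅`); different branches may section at different elements.

* `TypedSectioning.card_le_card_terms_of_cert` — **a certified menu system has at least as many terms as minuends.**
* `TypedSectioning.card_le_card_of_cert` — the same against any family containing the terms.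

Why it is here (memo §1): for a depth-one saturated two-class antipodal instance take as minuends a transversal of the
complementary pairs of `𝒟` and as menu of `s` the members of `𝒟` whose label is close to that of `s` (alive–alive pairs removed);
the terms then lie in the candidate family `clU U (scTerms P Q W)`, and a certificate gives (Π2″).  Such certificates exist for every
derived configuration of the programme's corpora (exhaustive-`2^[6]` residues, the hybrid-only `#F = 8` type, the parallel family at
`n = 8`, random `n ≤ 7`), across the divide between the `F`-type and the hybrid rank certificates — the first single proof scheme to
do so.  The uniform theorem (which sectioning element always works) is open; this file is its vehicle.
-/

namespace Summit.CriticalPhenomena.PercolationContinuityZ3.Theorems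

namespace TypedSectioning

open Finset

variable {α : Type*} [DecidableEq α]

/-- The terms of a menu system: all differences `S \ T` with `S` a minuend and `T` on the menu of `S`. -/
def terms (𝒮 : Finset (Finset α)) (M : Finset α → Finset (Finset α)) : Finset (Finset α) :=
  𝒮.biUnion fun S => (M S).image fun T => S \ T

/-- The doubled child at `r`: minuends `X ∌ r` such that both `X` and `insert r X` are minuends. -/
def dbl (𝒮 : Finset (Finset α)) (r : α) : Finset (Finset α) :=
  𝒮.filter fun X => r ∉ X ∧ insert r X ∈ 𝒮

/-- The menu of the doubled child: subtrahends avoiding `r` that serve both `X` and `insert r X`. -/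
def dblMenu (M : Finset α → Finset (Finset α)) (r : α) : Finset α → Finset (Finset α) :=
  fun X => (M X ∩ M (insert r X)).filter fun T => r ∉ T

/-- The projected child at `r`: the minuends with `r` erased. -/
def proj (𝒮 : Finset (Finset α)) (r : α) : Finset (Finset α) :=
  𝒮.image fun S => S.erase r

/-- The menu of the projected child: for a projected minuend, the projections of the menus of all its preimages. -/
def projMenu (𝒮 : Finset (Finset α)) (M : Finset α → Finset (Finset α)) (r : α) :
    Finset α → Finset (Finset α) :=
  fun S' => (𝒮.filter fun S => S.erase r = S').biUnion fun S => (M S).image fun T => T.erase r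

/-- **Sectioning certificates.**  The empty system and the system `{∅}` with `∅ ∈ M ∅` are certified; a system is certified if,
for some element `r`, both its doubled child and its projected child at `r` are certified. -/
inductive Cert : Finset (Finset α) → (Finset α → Finset (Finset α)) → Prop
  | empty (M : Finset α → Finset (Finset α)) : Cert ∅ M
  | leaf (M : Finset α → Finset (Finset α)) (h : (∅ : Finset α) ∈ M ∅) : Cert {∅} M
  | step (𝒮 : Finset (Finset α)) (M : Finset α → Finset (Finset α)) (r : α)
      (h₁ : Cert (dbl 𝒮 r) (dblMenu M r)) (h₂ : Cert (proj 𝒮 r) (projMenu 𝒮 M r)) : Cert 𝒮 M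

/-- Membership in `terms`. -/
theorem mem_terms {𝒮 : Finset (Finset α)} {M : Finset α → Finset (Finset α)} {E : Finset α} :
    E ∈ terms 𝒮 M ↔ ∃ S ∈ 𝒮, ∃ T ∈ M S, S \ T = E := by
  unfold terms
  simp only [mem_biUnion, mem_image]

/-- Membership in `dbl`. -/
theorem mem_dbl {𝒮 : Finset (Finset α)} {r : α} {X : Finset α} :
    X ∈ dbl 𝒮 r ↔ X ∈ 𝒮 ∧ r ∉ X ∧ insert r X ∈ 𝒮 := by
  unfold dbl; rw [mem_filter]

/-- Membership in `dblMenu`. -/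
theorem mem_dblMenu {M : Finset α → Finset (Finset α)} {r : α} {X T : Finset α} :
    T ∈ dblMenu M r X ↔ T ∈ M X ∧ T ∈ M (insert r X) ∧ r ∉ T := by
  unfold dblMenu; rw [mem_filter, mem_inter, and_assoc]

/-- Membership in `proj`. -/
theorem mem_proj {𝒮 : Finset (Finset α)} {r : α} {S' : Finset α} :
    S' ∈ proj 𝒮 r ↔ ∃ S ∈ 𝒮, S.erase r = S' := by
  unfold proj; rw [mem_image]

/-- Membership in `projMenu`. -/
theorem mem_projMenu {𝒮 : Finset (Finset α)} {M : Finset α → Finset (Finset α)} {r : α} {S' T' : Finset α} :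
    T' ∈ projMenu 𝒮 M r S' ↔ ∃ S ∈ 𝒮, S.erase r = S' ∧ ∃ T ∈ M S, T.erase r = T' := by
  unfold projMenu
  simp only [mem_biUnion, mem_filter, mem_image, and_assoc]

/-- Sectioning count (as in the proof of Ahlswede–Daykin's Theorem 37): `#𝒮 = #(dbl 𝒮 r) + #(proj 𝒮 r)` — the fibres of
`S ↦ S.erase r` have one or two elements, two exactly over the doubled family. -/
theorem card_eq_card_dbl_add_card_proj (𝒮 : Finset (Finset α)) (r : α) :
    #𝒮 = #(dbl 𝒮 r) + #(proj 𝒮 r) := by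
  set 𝒮₀ := 𝒮.filter fun S => r ∉ S with h𝒮₀
  set 𝒮p := 𝒮.filter fun S => r ∈ S with h𝒮p
  have hsplit : #𝒮 = #𝒮p + #𝒮₀ := (card_filter_add_card_filter_not (fun S => r ∈ S)).symm
  have himg : proj 𝒮 r = 𝒮₀ ∪ 𝒮p.image fun S => S.erase r := by
    ext E
    unfold proj
    simp only [mem_image, mem_union, h𝒮₀, h𝒮p, mem_filter]
    constructor
    · rintro ⟨S, hS, rfl⟩
      by_cases hr : r ∈ S
      · exact Or.inr ⟨S, ⟨hS, hr⟩, rfl⟩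
      · exact Or.inl ⟨by rwa [erase_eq_of_notMem hr], notMem_erase r S⟩
    · rintro (⟨hE, hrE⟩ | ⟨S, ⟨hS, -⟩, rfl⟩)
      · exact ⟨E, hE, erase_eq_of_notMem hrE⟩
      · exact ⟨S, hS, rfl⟩
  have hinj : Set.InjOn (fun S => S.erase r) (𝒮p : Set (Finset α)) := by
    intro S hS S' hS' h
    have hrS : r ∈ S := (mem_filter.1 hS).2
    have hrS' : r ∈ S' := (mem_filter.1 hS').2
    have h' : S.erase r = S'.erase r := h
    rw [← insert_erase hrS, h', insert_erase hrS']
  have hcardp : #(𝒮p.image fun S => S.erase r) = #𝒮p := card_image_of_injOn hinj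
  have hinter : 𝒮₀ ∩ 𝒮p.image (fun S => S.erase r) = dbl 𝒮 r := by
    ext E
    unfold dbl
    simp only [mem_inter, mem_image, h𝒮₀, h𝒮p, mem_filter]
    constructor
    · rintro ⟨⟨hE, hrE⟩, S, ⟨hS, hrS⟩, hSE⟩
      refine ⟨hE, hrE, ?_⟩
      rwa [← hSE, insert_erase hrS]
    · rintro ⟨hE, hrE, hins⟩
      exact ⟨⟨hE, hrE⟩, insert r E, ⟨hins, mem_insert_self r E⟩, erase_insert hrE⟩
  rw [himg, ← hinter, hsplit, ← hcardp]
  have := card_union_add_card_inter 𝒮₀ (𝒮p.image fun S => S.erase r)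
  omega

/-- A term of the doubled child is a term of the system, and so is its union with `r` (which it does not contain). -/
theorem mem_terms_of_mem_terms_dbl {𝒮 : Finset (Finset α)} {M : Finset α → Finset (Finset α)} {r : α}
    {E : Finset α} (hE : E ∈ terms (dbl 𝒮 r) (dblMenu M r)) :
    E ∈ terms 𝒮 M ∧ insert r E ∈ terms 𝒮 M ∧ r ∉ E := by
  obtain ⟨X, hX, T, hT, rfl⟩ := mem_terms.mp hE
  obtain ⟨hX𝒮, hrX, hXr⟩ := mem_dbl.mp hX
  obtain ⟨hTX, hTXr, hrT⟩ := mem_dblMenu.mp hT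
  refine ⟨mem_terms.mpr ⟨X, hX𝒮, T, hTX, rfl⟩, mem_terms.mpr ⟨insert r X, hXr, T, hTXr, ?_⟩,
    fun h => hrX (mem_sdiff.mp h).1⟩
  rw [insert_sdiff_of_notMem _ hrT]

/-- A term of the projected child is a term of the system with `r` erased; hence it or its union with `r` is a term. -/
theorem exists_of_mem_terms_proj {𝒮 : Finset (Finset α)} {M : Finset α → Finset (Finset α)} {r : α}
    {E : Finset α} (hE : E ∈ terms (proj 𝒮 r) (projMenu 𝒮 M r)) :
    r ∉ E ∧ ∃ D ∈ terms 𝒮 M, D.erase r = E := by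
  obtain ⟨S', hS', T', hT', rfl⟩ := mem_terms.mp hE
  obtain ⟨S, hS, hSS', T, hT, rfl⟩ := mem_projMenu.mp hT'
  refine ⟨fun h => ?_, S \ T, mem_terms.mpr ⟨S, hS, T, hT, rfl⟩, ?_⟩
  · rw [← hSS'] at h
    exact (notMem_erase r S) (mem_sdiff.mp h).1
  · rw [← hSS']
    ext i
    simp only [mem_erase, mem_sdiff]
    tauto

/-- **The gluing step** (no hypothesis on the menus): the terms of the two children at `r` inject disjointly into the terms
of the system — `E ↦ insert r E` on the doubled child; `E ↦ E` if `E` is a term, else `E ↦ insert r E`, on the projected child. -/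
theorem card_terms_dbl_add_card_terms_proj_le (𝒮 : Finset (Finset α)) (M : Finset α → Finset (Finset α)) (r : α) :
    #(terms (dbl 𝒮 r) (dblMenu M r)) + #(terms (proj 𝒮 r) (projMenu 𝒮 M r)) ≤ #(terms 𝒮 M) := by
  classical
  set T₀ := terms 𝒮 M with hT₀
  set T₁ := terms (dbl 𝒮 r) (dblMenu M r) with hT₁
  set T₂ := terms (proj 𝒮 r) (projMenu 𝒮 M r) with hT₂
  let φ : Finset α → Finset α := fun E => if E ∈ T₀ then E else insert r E
  have hA : T₁.image (fun E => insert r E) ⊆ T₀ := by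
    intro x hx
    obtain ⟨E, hE, rfl⟩ := mem_image.mp hx
    exact (mem_terms_of_mem_terms_dbl hE).2.1
  have hB : T₂.image φ ⊆ T₀ := by
    intro x hx
    obtain ⟨E, hE, rfl⟩ := mem_image.mp hx
    by_cases h : E ∈ T₀
    · simp only [φ, if_pos h]; exact h
    · simp only [φ, if_neg h]
      obtain ⟨hrE, D, hD, hDE⟩ := exists_of_mem_terms_proj hE
      by_cases hrD : r ∈ D
      · have : insert r E = D := by rw [← hDE, insert_erase hrD]
        rw [this]; exact hD
      · have : D = E := by rw [← hDE, erase_eq_of_notMem hrD]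
        rw [this] at hD; exact absurd hD h
  have hinjA : Set.InjOn (fun E => insert r E) (T₁ : Set (Finset α)) := by
    intro E hE E' hE' h
    have hrE := (mem_terms_of_mem_terms_dbl (mem_coe.mp hE)).2.2
    have hrE' := (mem_terms_of_mem_terms_dbl (mem_coe.mp hE')).2.2
    have h' : insert r E = insert r E' := h
    rw [← erase_insert hrE, h', erase_insert hrE']
  have hinjB : Set.InjOn φ (T₂ : Set (Finset α)) := by
    intro E hE E' hE' h
    have hrE := (exists_of_mem_terms_proj (mem_coe.mp hE)).1
    have hrE' := (exists_of_mem_terms_proj (mem_coe.mp hE')).1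
    have key : (φ E).erase r = E := by
      by_cases h1 : E ∈ T₀
      · simp only [φ, if_pos h1]; exact erase_eq_of_notMem hrE
      · simp only [φ, if_neg h1]; exact erase_insert hrE
    have key' : (φ E').erase r = E' := by
      by_cases h1 : E' ∈ T₀
      · simp only [φ, if_pos h1]; exact erase_eq_of_notMem hrE'
      · simp only [φ, if_neg h1]; exact erase_insert hrE'
    have h'' : φ E = φ E' := h
    rw [← key, h'', key']
  have hdisj : Disjoint (T₁.image fun E => insert r E) (T₂.image φ) := by
    rw [Finset.disjoint_left]
    intro x hx hx'
    obtain ⟨E, hE, rfl⟩ := mem_image.mp hx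
    obtain ⟨E', hE', hEq⟩ := mem_image.mp hx'
    have hE₀ : E ∈ T₀ := (mem_terms_of_mem_terms_dbl hE).1
    have hrE' := (exists_of_mem_terms_proj hE').1
    by_cases h1 : E' ∈ T₀
    · simp only [φ, if_pos h1] at hEq
      rw [hEq] at hrE'
      exact hrE' (mem_insert_self r E)
    · simp only [φ, if_neg h1] at hEq
      have hrE := (mem_terms_of_mem_terms_dbl hE).2.2
      have : E' = E := by rw [← erase_insert hrE', hEq, erase_insert hrE]
      rw [this] at h1
      exact h1 hE₀
  calc #T₁ + #T₂ = #(T₁.image fun E => insert r E) + #(T₂.image φ) := by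
          rw [card_image_of_injOn hinjA, card_image_of_injOn hinjB]
    _ = #((T₁.image fun E => insert r E) ∪ T₂.image φ) := (card_union_of_disjoint hdisj).symm
    _ ≤ #T₀ := card_le_card (union_subset hA hB)

/-- **A certified menu system has at least as many terms as minuends** (hp-7 gen 81: typed Ahlswede–Daykin sectioning). -/
theorem card_le_card_terms_of_cert {𝒮 : Finset (Finset α)} {M : Finset α → Finset (Finset α)} (h : Cert 𝒮 M) :
    #𝒮 ≤ #(terms 𝒮 M) := by
  induction h with
  | empty M => simp
  | leaf M h =>
    rw [card_singleton]
    exact card_pos.mpr ⟨∅, mem_terms.mpr ⟨∅, mem_singleton_self _, ∅, h, sdiff_self⟩⟩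
  | step 𝒮 M r h₁ h₂ ih₁ ih₂ =>
    rw [card_eq_card_dbl_add_card_proj 𝒮 r]
    exact (Nat.add_le_add ih₁ ih₂).trans (card_terms_dbl_add_card_terms_proj_le 𝒮 M r)

/-- A certified menu system whose terms lie in a family `T` has at most `#T` minuends. -/
theorem card_le_card_of_cert {𝒮 T : Finset (Finset α)} {M : Finset α → Finset (Finset α)} (h : Cert 𝒮 M)
    (hT : terms 𝒮 M ⊆ T) : #𝒮 ≤ #T :=
  (card_le_card_terms_of_cert h).trans (card_le_card hT)

end TypedSectioning

end Summit.CriticalPhenomena.PercolationContinuityZ3.Theorems
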